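import Summits.BirchSwinnertonDyer.BirchSwinnertonDyer.Theorems.PAdicOrderV2PAdicOrderComparisonR2StubConstantCoeff
import Summits.BirchSwinnertonDyer.BirchSwinnertonDyer.Theorems.PAdicOrderV2PAdicOrderComparisonR2StubParity

/-!
# Crux `PAdicOrderComparisonR2` (stmt-BirchSwinnertonDyer-0489), line `Sketch` — stub L2:
# `ord_{s=1} L(E,s) = 2 ⇒ 2 ≤ ord_{T=0} L_p(E,T)` at every good ordinary prime

Registered stub `stub_two_le_order_of_analyticRank_eq_two` of the skeleton
`Cruxes/PAdicOrderComparisonR2/Lines/Sketch.lean` (v3): for `E/ℚ` (globally minimal `W`), a good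
ordinary prime `p` (`p = 2` included), and the newform `f` of `E` of any level, if the analytic rank
is `2` then the unit-root `p`-adic `L`-function `L_p(E,T) = padicLFunction f (unitRoot W p)`
vanishes to order at least `2` at `T = 0`.

Proof — the two LANDED legs of the line, and nothing else:
* S1 `stub_constantCoeff_eq_zero_iff` (interpolation, Mazur–Tate–Teitelbaum 1986 §I.14):
  `L_p(E,0) = 0 ↔ 1 ≤ r_an`, so `r_an = 2` gives `1 ≤ ord_T L_p`;
* S2 `stub_even_order_iff_even_analyticRank` (the `p`-adic and complex functional equations have
  the same sign `-ε(f)`; Greenberg, LNM 1716, §5, p. 181): `ord_T L_p ≡ r_an (mod 2)`, so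
  `ord_T L_p = 1` is impossible when `r_an = 2`.
Hence `ord_T L_p ∉ {0, 1}`, i.e. `2 ≤ ord_T L_p` in `ℕ∞` (the case `ord = ⊤` being trivial).
This is the lower-bound half of crux #2 in the first open case `r_an = 2`; it was the ideator's
lemma `twoLeOrderOfAnalyticRankTwo`, there relative to three named facts, here hypothesis-free.
-/

set_option linter.dupNamespace false

namespace Summit.BirchSwinnertonDyer.BirchSwinnertonDyer.Theorems

/-- **`r_an = 2 ⇒ 2 ≤ ord_{T=0} L_p(E,T)`** at every good ordinary prime `p` and for the newform
`f` of `E` at any level: from `L_p(E,0) = 0 ↔ 1 ≤ r_an` (`stub_constantCoeff_eq_zero_iff`,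
Mazur–Tate–Teitelbaum interpolation) and `ord_T L_p ≡ r_an (mod 2)`
(`stub_even_order_iff_even_analyticRank`, Greenberg: "The 'signs' in the functional equations for
`L_p(E/ℚ, s)` and `L(E/ℚ, s)` are the same"), an order that is `≥ 1` and even is `≥ 2`.
[cite: GreenbergLNM1716, §5 (p. 181)] -/
theorem stub_two_le_order_of_analyticRank_eq_two :
    ∀ (W : WeierstrassCurve ℚ) [W.IsElliptic] [W.IsGloballyMinimal] (p : ℕ) [Fact p.Prime],
      Literature.NumberTheory.EllipticCurves.IsOrdinaryAt W p →
      ∀ {N : ℕ} [NeZero N] (f : CuspForm (CongruenceSubgroup.Gamma0 N) 2),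
      Literature.NumberTheory.EllipticCurves.ModularForms.IsNewformOf W f →
        W.analyticRank = 2 →
          (2 : ℕ∞) ≤ (Literature.NumberTheory.EllipticCurves.padicLFunction f
            (Literature.NumberTheory.EllipticCurves.unitRoot W p : ℚ_[p])).order := by
  intro W _ _ p _ hord N _ f hf hr
  have hc : PowerSeries.constantCoeff (Literature.NumberTheory.EllipticCurves.padicLFunction f
      (Literature.NumberTheory.EllipticCurves.unitRoot W p : ℚ_[p])) = 0 :=
    (stub_constantCoeff_eq_zero_iff W p hord f hf).mpr (by omega)
  have hpar := stub_even_order_iff_even_analyticRank W p hord f hf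
  have h1le : ((1 : ℕ) : ℕ∞) ≤ (Literature.NumberTheory.EllipticCurves.padicLFunction f
      (Literature.NumberTheory.EllipticCurves.unitRoot W p : ℚ_[p])).order := by
    refine PowerSeries.nat_le_order _ 1 fun i hi => ?_
    have hi0 : i = 0 := by omega
    subst hi0
    simpa only [PowerSeries.coeff_zero_eq_constantCoeff] using hc
  by_contra hlt
  push Not at hlt
  have hfin : (Literature.NumberTheory.EllipticCurves.padicLFunction f
      (Literature.NumberTheory.EllipticCurves.unitRoot W p : ℚ_[p])).order ≠ ⊤ := by
    intro htop
    rw [htop] at hlt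
    exact absurd hlt (by simp)
  obtain ⟨n, hn⟩ := ENat.ne_top_iff_exists.mp hfin
  rw [← hn] at h1le hlt hpar
  have hn1 : n = 1 := by
    norm_cast at h1le hlt
    omega
  have hev : Even W.analyticRank := ⟨1, by omega⟩
  have hodd := hpar.mpr hev
  rw [hn1] at hodd
  simp at hodd

end Summit.BirchSwinnertonDyer.BirchSwinnertonDyer.Theorems
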